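import Summits.AtomisticToContinuum.HydrodynamicLimit.Theorems.LambertianContactSwapLambertianEulerConfigMarkedKorolyuk
import Summits.AtomisticToContinuum.HydrodynamicLimit.Theorems.LambertianContactSwapLambertianEulerFastPairActivity
import HarnessLib

/-!
# Campbell's bound for configuration-marked Lambertian contacts at equilibrium
# (`LambertianContactSwap.LambertianEuler`, stmt-AtomisticToContinuum-11854, line `Sketch`; lead c10,
# piece W9 part 2: registered stub `lintegral_configMarkedContacts_le`)

Support file (`--supports stmt-AtomisticToContinuum-11854`).  For `N + 1` hard spheres of diameter
`ε = hsDiameter σ N` on `𝕋³` driven by the Lambertian recursion (`z_m = lambertStateAfter`,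
`t_m = lambertInstant`, `K = lambertCount`, `Λ = lambertFlow`, noise `γ^ℕ = lambertNoise`) and the
equilibrium law `G_N` (rung 0: constant profiles `b, ϑ > 0`, `w`), put `μ := G_N ⊗ γ^ℕ`.  Let `wt` be a
mark of a pair read on the EXIT CONFIGURATION `z_m♭` of a collision (positions and velocities), and
`wt' ≥ 0` a measurable mark dominating it after transport along forward free flight of duration
`≤ u₀` from the domain (`wt q (S_u y) ≤ wt' q y`).  If the STATIC Gibbs weight of `wt'` on the
`h'`-shell pairs is linear in the width, `∫⁻ 𝟙{q shell-close, width h'} wt' q dG_N ≤ B h'` for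
`0 ≤ h' ≤ u₀`, then the `μ`-mean of the marked sum over the counted contacts of any window `(a', a'+h]`,

  `∫⁻ Σ_{m < K_{a'+h}, a' < t_{m+1}} Σ_q 𝟙{q ∈ incomingPairs z_m♭} wt q z_m♭ dμ ≤ (N+1)² B h`

(`lintegral_configMarkedContacts_le`) — Campbell's bound for the marked contact process, proved as in
`…FastPairActivity.fastPairActivity_equilibrium_le`: the pathwise marked Korolyuk inequality with
configuration marks (`…ConfigMarkedKorolyuk.configMarkedContacts_le_meshSum`) `μ`-a.e. (simple,
non-accumulating paths with simple incoming exits), Fatou, and one-time stationarity of `G_N` under `Λ`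
(`lintegral_meshSum_le`) with the static bound at width `h' = h/(n+1) ≤ u₀` (all large `n`).  Used by
lead c10 with the "third particle in a shell of a colliding particle, or fast pair" mark.

References: Daley–Vere-Jones, *An Introduction to the Theory of Point Processes* I, §3.3 and §6.4
(Korolyuk, Campbell); Cercignani–Illner–Pulvirenti 1994, §2.2.  All statements [folklore].
-/

noncomputable section

namespace Summit.AtomisticToContinuum.HydrodynamicLimit.Theorems.LambertianContactSwapLambertianEulerMarkedContactsMean

open scoped BigOperators Topology ENNReal InnerProductSpace
open MeasureTheory ProbabilityTheory Filter Set
open Literature.MathematicalPhysics.KineticTheory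
open Literature.Analysis.FluidPDE Literature.Analysis.FluidPDE.Alexander
open Summit.AtomisticToContinuum.HydrodynamicLimit.Theorems.LambertianContactSwapLambertianEulerEquilibriumCountStationarity
open Summit.AtomisticToContinuum.HydrodynamicLimit.Theorems.LambertianContactSwapLambertianEulerSimpleCollisions
open Summit.AtomisticToContinuum.HydrodynamicLimit.Theorems.LambertianContactSwapLambertianEulerRestartInLaw
open Summit.AtomisticToContinuum.HydrodynamicLimit.Theorems.LambertianContactSwapLambertianEulerConfigMarkedKorolyuk
open Summit.AtomisticToContinuum.HydrodynamicLimit.Theorems.LambertianContactSwapLambertianEulerFastPairActivity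

/-- **Campbell's bound for configuration-marked Lambertian contacts at equilibrium** (registered stub
`lintegral_configMarkedContacts_le` of lead c10, piece W9 part 2).  For `0 < σ < 1/2`, `N`, constant
profiles `b, ϑ > 0`, `w`, a flow `Φ` (phase space only), marks `wt`, `wt'` of a pair read on a
configuration with `wt' ≥ 0` measurable and `wt q (S_u y) ≤ wt' q y` for `y` in the hard-sphere domain
and `0 ≤ u ≤ u₀` (`u₀ > 0`), and a static bound `∫⁻ 𝟙{q.1 ≠ q.2, ε ≤ d_q ≤ ε + h'‖Δv_q‖} wt' q dG_N ≤ B h'`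
for all `0 ≤ h' ≤ u₀` and all `q` (`B ≥ 0`): for every window `0 ≤ a'`, `0 < h`, the `G_N ⊗ γ^ℕ`-mean
of `Σ_{m < K_{a'+h}, a' < t_{m+1}} Σ_q 𝟙{q ∈ incomingPairs z_m♭} wt q z_m♭` is `≤ (N+1)² B h` — marked
Korolyuk a.e., Fatou, stationarity. [folklore] -/
theorem lintegral_configMarkedContacts_le :
    ∀ {σ : ℝ}, 0 < σ → σ < 2⁻¹ → ∀ (N : ℕ) (b ϑ : ℝ) (w : V3), 0 < b → 0 < ϑ →
      ∀ (Φ : HardSphereFlow (Torus.geometry (Fin 3)) (hsDiameter σ N) (N + 1))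
        (wt wt' : Fin (N + 1) × Fin (N + 1) → Config (N + 1) (Fin 3) T3 → ℝ),
        (∀ q y, 0 ≤ wt' q y) → (∀ q, Measurable fun y => wt' q y) →
        ∀ u₀ : ℝ, 0 < u₀ →
          (∀ (q : Fin (N + 1) × Fin (N + 1)) (y : Config (N + 1) (Fin 3) T3) (u : ℝ),
              y ∈ hardSphereDomain (Torus.geometry (Fin 3)) (N + 1) (hsDiameter σ N) → 0 ≤ u → u ≤ u₀ →
              wt q (freeFlight (Torus.geometry (Fin 3)) u y) ≤ wt' q y) →
          ∀ B : ℝ, 0 ≤ B →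
            (∀ h' : ℝ, 0 ≤ h' → h' ≤ u₀ → ∀ q : Fin (N + 1) × Fin (N + 1),
                ∫⁻ y, ENNReal.ofReal
                    (if q.1 ≠ q.2 ∧ hsDiameter σ N ≤ ‖(Torus.geometry (Fin 3)).sepVec (y q.1).1 (y q.2).1‖ ∧
                        ‖(Torus.geometry (Fin 3)).sepVec (y q.1).1 (y q.2).1‖ ≤
                          hsDiameter σ N + h' * ‖(y q.1).2 - (y q.2).2‖
                      then wt' q y else 0)
                  ∂(localGibbsLaw σ (fun _ => b) (fun _ => w) (fun _ => ϑ) N Φ) ≤ ENNReal.ofReal (B * h')) →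
            ∀ (a' h : ℝ), 0 ≤ a' → 0 < h →
              ∫⁻ p, ENNReal.ofReal
                  (∑ m ∈ Finset.range (lambertCount (Torus.geometry (Fin 3)) (hsDiameter σ N) p.2 p.1 (a' + h)),
                    if a' < (lambertInstant (Torus.geometry (Fin 3)) (hsDiameter σ N) p.2 p.1 (m + 1)).toReal then
                      ∑ q : Fin (N + 1) × Fin (N + 1),
                        (incomingPairs (Torus.geometry (Fin 3)) (hsDiameter σ N)
                          (freeFlight (Torus.geometry (Fin 3))
                            (freeExitTime (Torus.geometry (Fin 3)) (hsDiameter σ N)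
                              (lambertStateAfter (Torus.geometry (Fin 3)) (hsDiameter σ N) p.2 p.1 m)).toReal
                            (lambertStateAfter (Torus.geometry (Fin 3)) (hsDiameter σ N) p.2 p.1 m))).indicator
                          (fun q' => wt q' (freeFlight (Torus.geometry (Fin 3))
                            (freeExitTime (Torus.geometry (Fin 3)) (hsDiameter σ N)
                              (lambertStateAfter (Torus.geometry (Fin 3)) (hsDiameter σ N) p.2 p.1 m)).toReal
                            (lambertStateAfter (Torus.geometry (Fin 3)) (hsDiameter σ N) p.2 p.1 m))) q
                    else 0)
                ∂((localGibbsLaw σ (fun _ => b) (fun _ => w) (fun _ => ϑ) N Φ).prod (lambertNoise (Fin 3))) ≤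
              ENNReal.ofReal (((N : ℝ) + 1) ^ 2 * B * h) := by
  intro σ hσ hσ' N b ϑ w hb hϑ Φ wt wt' hwt'0 hwt'm u₀ hu₀ htrans B hB hstat a' h ha' hh
  haveI := isProbabilityMeasure_localGibbsLaw_const hσ' N w hb hϑ Φ
  -- notation
  set G := localGibbsLaw σ (fun _ => b) (fun _ => w) (fun _ => ϑ) N Φ with hGdef
  set μ : Measure (Config (N + 1) (Fin 3) T3 × (ℕ → V3)) := G.prod (lambertNoise (Fin 3)) with hμ
  have hε : 0 < hsDiameter σ N := hsDiameter_pos hσ N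
  have hε' : hsDiameter σ N < 2⁻¹ := (hsDiameter_le hσ.le N).trans_lt hσ'
  have hGac : G ≪ liouville (Torus.geometry (Fin 3)) (N + 1) (hsDiameter σ N) :=
    localGibbsLaw_absolutelyContinuous σ _ _ _ N Φ
  -- Step 0: the shell-marked summand `F δ` (nonnegative, measurable, of `G`-mean `≤ B δ` for `δ ≤ u₀`)
  set F : ℝ → Fin (N + 1) × Fin (N + 1) → Config (N + 1) (Fin 3) T3 → ℝ := fun δ q y =>
    if q.1 ≠ q.2 ∧ hsDiameter σ N ≤ ‖(Torus.geometry (Fin 3)).sepVec (y q.1).1 (y q.2).1‖ ∧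
        ‖(Torus.geometry (Fin 3)).sepVec (y q.1).1 (y q.2).1‖ ≤ hsDiameter σ N + δ * ‖(y q.1).2 - (y q.2).2‖
      then wt' q y else 0 with hF
  have hF0 : ∀ δ q y, 0 ≤ F δ q y := by
    intro δ q y
    simp only [hF]
    split_ifs
    · exact hwt'0 q y
    · exact le_rfl
  have hFm : ∀ δ q, Measurable fun y => F δ q y := by
    intro δ q
    have hf : Measurable fun y : Config (N + 1) (Fin 3) T3 =>
        ‖(Torus.geometry (Fin 3)).sepVec (y q.1).1 (y q.2).1‖ :=
      (Torus.measurable_geometry_sepVec.comp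
        ((measurable_pi_apply q.1).fst.prodMk (measurable_pi_apply q.2).fst)).norm
    have hg : Measurable fun y : Config (N + 1) (Fin 3) T3 => ‖(y q.1).2 - (y q.2).2‖ :=
      ((measurable_pi_apply q.1).snd.sub (measurable_pi_apply q.2).snd).norm
    simp only [hF]
    exact Measurable.ite ((MeasurableSet.const _).inter ((measurableSet_le measurable_const hf).inter
      (measurableSet_le hf ((hg.const_mul δ).const_add _)))) (hwt'm q) measurable_const
  -- Step 1: the hypotheses of the pathwise marked Korolyuk inequality hold almost surely
  have hH1 := ae_freeExitTime_lambertStateAfter_pos hσ hσ' N G hGac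
  have hH2 := ae_nonAccumulation_of_absolutelyContinuous hσ hσ' N G hGac
  have hH3 : ∀ᵐ p ∂μ, p.1 ∈ hardSphereDomain (Torus.geometry (Fin 3)) (N + 1) (hsDiameter σ N) ∧
      ∀ k, freeExitTime (Torus.geometry (Fin 3)) (hsDiameter σ N)
          (lambertStateAfter (Torus.geometry (Fin 3)) (hsDiameter σ N) p.2 p.1 k) ≠ ⊤ →
        IsSimpleIncoming (Torus.geometry (Fin 3)) (hsDiameter σ N)
          (freeFlight (Torus.geometry (Fin 3))
            (freeExitTime (Torus.geometry (Fin 3)) (hsDiameter σ N)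
              (lambertStateAfter (Torus.geometry (Fin 3)) (hsDiameter σ N) p.2 p.1 k)).toReal
            (lambertStateAfter (Torus.geometry (Fin 3)) (hsDiameter σ N) p.2 p.1 k)) := by
    have h0 := (Measure.quasiMeasurePreserving_fst
      (μ := liouville (Torus.geometry (Fin 3)) (N + 1) (hsDiameter σ N)) (ν := lambertNoise (Fin 3))).ae
      (ae_liouville_mem_and_not_mem_contactSet (N := N + 1) hε.ne')
    refine (hGac.prod Measure.AbsolutelyContinuous.rfl).ae_le ?_
    filter_upwards [LambertianContactSwapLambertianEulerFwdGood.lambert_ae_fwdGood hε hε' (N := N + 1), h0]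
      with p hp hp0
    exact ⟨hp0.1, hp.1⟩
  -- Step 2: the mesh sums `R n` of the window, their measurability and their means (large `n`)
  set R : ℕ → Config (N + 1) (Fin 3) T3 × (ℕ → V3) → ℝ≥0∞ := fun n p => ENNReal.ofReal
    (∑ j ∈ Finset.range (n + 1), ∑ q : Fin (N + 1) × Fin (N + 1),
      F (h / ((n : ℝ) + 1)) q (lambertFlow (Torus.geometry (Fin 3)) (hsDiameter σ N) p.2 p.1
        (a' + (j : ℝ) * (h / ((n : ℝ) + 1))))) with hR
  have hRm : ∀ n, Measurable (R n) := fun n =>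
    (measurable_meshSum hσ.le hσ' N (hFm _) (fun j : ℕ => a' + (j : ℝ) * (h / ((n : ℝ) + 1))) n).ennreal_ofReal
  set bnd : ℝ≥0∞ := ENNReal.ofReal (((N : ℝ) + 1) ^ 2 * B * h) with hbnd
  have hev : ∀ᶠ n : ℕ in atTop, h / ((n : ℝ) + 1) ≤ u₀ := by
    have h1 : Tendsto (fun n : ℕ => h * (1 / ((n : ℝ) + 1))) atTop (𝓝 (h * 0)) :=
      tendsto_one_div_add_atTop_nhds_zero_nat.const_mul h
    rw [mul_zero] at h1
    filter_upwards [h1.eventually_lt_const hu₀] with n hn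
    rw [← mul_one_div]
    exact hn.le
  have h3 : ∀ᶠ n : ℕ in atTop, ∫⁻ p, R n p ∂μ ≤ bnd := by
    filter_upwards [hev] with n hn
    have hn0 : (0 : ℝ) < (n : ℝ) + 1 := by positivity
    have hδ : 0 ≤ h / ((n : ℝ) + 1) := div_nonneg hh.le hn0.le
    refine (lintegral_meshSum_le hσ hσ' N b ϑ w hb hϑ Φ (hF0 _) (hFm _)
      (fun q => hstat _ hδ hn q) (s := fun j : ℕ => a' + (j : ℝ) * (h / ((n : ℝ) + 1)))
      (fun j => add_nonneg ha' (mul_nonneg (Nat.cast_nonneg _) hδ)) n).trans_eq ?_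
    rw [hbnd]
    congr 1
    field_simp
  -- Step 3: the pathwise inequality almost surely (through the monotone `ofReal`), Fatou, assembly
  refine (lintegral_mono_ae (g := fun p => liminf (fun n => R n p) atTop) ?_).trans ?_
  · filter_upwards [hH1, hH2, hH3] with p h1 h2 h3'
    refine le_liminf_of_le ?_ ?_
    · isBoundedDefault
    exact (configMarkedContacts_le_meshSum hσ hσ' N p.1 p.2 h3'.1 h1 h2 h3'.2 wt wt' hwt'0 u₀ hu₀ htrans
      a' h ha' hh).mono fun n hn => ENNReal.ofReal_le_ofReal hn
  · calc ∫⁻ p, liminf (fun n => R n p) atTop ∂μ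
        ≤ liminf (fun n => ∫⁻ p, R n p ∂μ) atTop := lintegral_liminf_le hRm
      _ ≤ liminf (fun _ : ℕ => bnd) atTop := liminf_le_liminf h3
      _ = bnd := liminf_const bnd

end Summit.AtomisticToContinuum.HydrodynamicLimit.Theorems.LambertianContactSwapLambertianEulerMarkedContactsMean

end
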